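import Literature.Geometry.ComplexAnalytic.PhamBrieskornFibreSymmetries
import Mathlib.Analysis.SpecialFunctions.Complex.Circle
import HarnessLib

/-!
# The weighted circle action `zᵢ ↦ e^{iθ/aᵢ} zᵢ` of a Pham–Brieskorn polynomial: it multiplies `Σ zᵢ^{aᵢ}` by
# `e^{iθ}`, preserves all moduli, and at `θ = 2π` is the monodromy `(e^{2πi/aᵢ})ᵢ`; the model isotopy in a Morse chart

Layer `Literature/Geometry/ComplexAnalytic`; theorems only (no definition, no named fact). Written by the prover seat
`hodge-nonav-prover-Ax` (g10) for the programme "localisation of the nodal meridian monodromy" (crux K1 of the route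
`Summits/HodgeConjecture/HodgeConjecture/Theses/CyclicUnitaryPowers.lean`).

For exponents `a : ι → ℕ`, all `≠ 0`, the quasi-homogeneous polynomial `P(z) = Σᵢ zᵢ^{aᵢ}` is equivariant for the
weighted circle action `R_θ(z)ᵢ = e^{iθ/aᵢ} · zᵢ`: `P(R_θ z) = e^{iθ} P(z)` (Milnor 1968 §9, Lemma 9.4: "`h_t(z) =
(e^{it/a₁} z₁, …, e^{it/aₙ} zₙ)` […] carries each fibre `F_θ` to `F_{θ+t}`"; Dimca 1992 Ch. 3 (1.19); AGZV II §2.3). So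
`R_θ` carries the Milnor fibre `{P = c}` onto `{P = e^{iθ}c}` inside every ball `Σ λᵢ|zᵢ|² < C` (all moduli are
preserved), and the MONODROMY of the Milnor fibration of `P` is `R_{2π} = (e^{2πi/aᵢ})ᵢ` — for the cyclic node
`(2, 2, p)` the map `(−z₀, −z₁, ζ_p z₂)`, `ζ_p = e^{2πi/p}` (Carlson–Toledo §6: "`T = σ₀ ⊗ (−1) ⊗ (−1)`"). All maps
are written out explicitly (no definitions):

* `sum_pow_weightedRotation` — `Σ (e^{iθ/aᵢ} zᵢ)^{aᵢ} = e^{iθ} Σ zᵢ^{aᵢ}`; `norm_weightedRotation_apply` — moduli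
  preserved; `weightedRotation_zero/add/two_pi` — flow law and the value at `2π`; `continuous_weightedRotation`;
* `weightedRotation_two_pi_cyclicNode` — for `a = (2, 2, p)`: `R_{2π} z = (−z₀, −z₁, e^{2πi/p} z₂)`, and
  `isPrimitiveRoot_exp_two_pi_div` — `e^{2πi/p}` is a primitive `p`-th root of unity;
* THE MODEL ISOTOPY IN A MORSE CHART (`modelIsotopy_mem`, `apply_modelIsotopy_eq_exp_mul`, `modelIsotopy_zero`,
  `modelIsotopy_add`, `chart_modelIsotopy_two_pi`, `continuousOn_modelIsotopy`): for an open partial homeomorphism `Θ`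
  of a space `E` into `ℂ^ι`, a function `φ : E → ℂ` with `Σ (Θ x)ᵢ^{aᵢ} = φ x` on `Θ.source`, and a radius `r` with
  the closed ball `Σ|zᵢ|² ≤ r²` inside `Θ.target`, the maps `I_θ = Θ⁻¹ ∘ R_θ ∘ Θ` form a continuous flow on the open
  set `V = Θ⁻¹{Σ|zᵢ|² < r²}`, preserving `V` and the function `Σ|(Θ x)ᵢ|²`, covering the rotation
  (`φ (I_θ x) = e^{iθ} φ x`), with `I_0 = id` and `Θ ∘ I_{2π} = R_{2π} ∘ Θ`.

## References

* [Milnor1968] J. Milnor, Singular Points of Complex Hypersurfaces, §9, Lemma 9.4 and p. 77 (`h_{2π} | J`).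
* [Dimca1992] A. Dimca, Singularities and Topology of Hypersurfaces, Ch. 3 (1.19) (monodromy of a weighted homogeneous
  polynomial; held text p0078).
* [ArnoldGuseinzadeVarchenko2012] V. I. Arnold, S. M. Gusein-Zade, A. N. Varchenko, Singularities of Differentiable Maps,
  Vol. 2, Part I §2.3.
* [CarlsonToledo1999] J. A. Carlson, D. Toledo, Duke Math. J. 97 (1999), §6 (kdoublept) (held text p0013).
-/

noncomputable section

open Complex Set Filter Function
open scoped Real Topology

namespace Literature.Geometry.ComplexAnalytic

namespace PhamBrieskorn

/-! ### The weighted rotation `zᵢ ↦ e^{iθ/aᵢ} zᵢ` -/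

section Rotation

variable {ι : Type} [Fintype ι] (a : ι → ℕ)

/-- `(e^{iθ/a})^a = e^{iθ}` for `a ≠ 0`. [cite: Milnor1968, §9 Lemma 9.4] -/
theorem exp_div_mul_I_pow {n : ℕ} (hn : n ≠ 0) (θ : ℝ) :
    Complex.exp (((θ / n : ℝ) : ℂ) * I) ^ n = Complex.exp ((θ : ℂ) * I) := by
  rw [← Complex.exp_nat_mul]
  congr 1
  have hn' : (n : ℂ) ≠ 0 := by exact_mod_cast hn
  push_cast
  field_simp

/-- **`P(R_θ z) = e^{iθ} P(z)`**: the weighted rotation multiplies the Pham–Brieskorn polynomial by `e^{iθ}`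
("`h_t` carries each fibre `F_θ` to `F_{θ+t}`"). [cite: Milnor1968, §9 Lemma 9.4] [cite: Dimca1992, Ch. 3 (1.19) (held text p0078)] -/
theorem sum_pow_weightedRotation (ha : ∀ i, a i ≠ 0) (θ : ℝ) (z : ι → ℂ) :
    ∑ i, (Complex.exp (((θ / a i : ℝ) : ℂ) * I) * z i) ^ a i = Complex.exp ((θ : ℂ) * I) * ∑ i, z i ^ a i := by
  rw [Finset.mul_sum]
  refine Finset.sum_congr rfl fun i _ => ?_
  rw [mul_pow, exp_div_mul_I_pow (ha i)]

omit [Fintype ι] in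
/-- The weighted rotation preserves every modulus `|zᵢ|`. [cite: Milnor1968, §9 Lemma 9.4] -/
theorem norm_weightedRotation_apply (θ : ℝ) (z : ι → ℂ) (i : ι) :
    ‖Complex.exp (((θ / a i : ℝ) : ℂ) * I) * z i‖ = ‖z i‖ := by
  rw [norm_mul, Complex.norm_exp_ofReal_mul_I, one_mul]

/-- Hence it preserves `Σ λᵢ |zᵢ|²` (balls, weighted ellipsoids, spheres). [cite: Milnor1968, §9 Lemma 9.4] -/
theorem sum_mul_norm_sq_weightedRotation (lam : ι → ℝ) (θ : ℝ) (z : ι → ℂ) :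
    ∑ i, lam i * ‖Complex.exp (((θ / a i : ℝ) : ℂ) * I) * z i‖ ^ 2 = ∑ i, lam i * ‖z i‖ ^ 2 := by
  simp_rw [norm_weightedRotation_apply]

omit [Fintype ι] in
/-- `R_0 = id`. [cite: Milnor1968, §9 Lemma 9.4] -/
theorem weightedRotation_zero (z : ι → ℂ) :
    (fun i => Complex.exp ((((0 : ℝ) / a i : ℝ) : ℂ) * I) * z i) = z := by
  funext i; simp

omit [Fintype ι] in
/-- Flow law `R_{θ+θ'} = R_θ ∘ R_{θ'}`. [cite: Milnor1968, §9 Lemma 9.4] -/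
theorem weightedRotation_add (θ θ' : ℝ) (z : ι → ℂ) :
    (fun i => Complex.exp ((((θ + θ') / a i : ℝ) : ℂ) * I) * z i) =
      fun i => Complex.exp (((θ / a i : ℝ) : ℂ) * I) * (Complex.exp (((θ' / a i : ℝ) : ℂ) * I) * z i) := by
  funext i
  rw [← mul_assoc, ← Complex.exp_add]
  congr 2
  push_cast
  ring

omit [Fintype ι] in
/-- The weighted rotation is jointly continuous in `(θ, z)`. [cite: Milnor1968, §9 Lemma 9.4] -/
theorem continuous_weightedRotation :
    Continuous fun q : ℝ × (ι → ℂ) => fun i => Complex.exp (((q.1 / a i : ℝ) : ℂ) * I) * q.2 i := by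
  refine continuous_pi fun i => ?_
  exact ((Complex.continuous_exp.comp ((Complex.continuous_ofReal.comp (continuous_fst.div_const _)).mul
    continuous_const)).mul ((continuous_apply i).comp continuous_snd))

/-- **`e^{2πi/n}` is a primitive `n`-th root of unity** (`n ≠ 0`; Milnor's `ω = e^{2πi/a}` generating `Ω_a`).
[cite: Milnor1968, §9 p. 76 (the cyclic group Ω_a)] -/
theorem isPrimitiveRoot_exp_two_pi_div {n : ℕ} (hn : n ≠ 0) :
    IsPrimitiveRoot (Complex.exp ((((2 * π) / n : ℝ) : ℂ) * I)) n := by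
  have h := Complex.isPrimitiveRoot_exp n hn
  convert h using 2
  push_cast
  ring

/-- **At `θ = 2π` the weighted rotation of the cyclic node `(2, 2, p)` is `(−z₀, −z₁, e^{2πi/p} z₂)`** — the model
monodromy of the tree (`negPairFibre ∘ rotateFibre`, Carlson–Toledo's "`T = σ₀ ⊗ (−1) ⊗ (−1)`").
[cite: CarlsonToledo1999, §6 (kdoublept) (held text p0013)] [cite: Milnor1968, §9 p. 77] -/
theorem weightedRotation_two_pi_cyclicNode (p : ℕ) (z : Fin (1 + 2) → ℂ) :
    (fun i => Complex.exp ((((2 * π) / cyclicNodeExponents p i : ℝ) : ℂ) * I) * z i) =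
      ![-z 0, -z 1, Complex.exp ((((2 * π) / p : ℝ) : ℂ) * I) * z 2] := by
  have hπ : Complex.exp ((((2 * π) / (2 : ℕ) : ℝ) : ℂ) * I) = -1 := by
    rw [show (((2 * π) / (2 : ℕ) : ℝ) : ℂ) * I = π * I by push_cast; ring, Complex.exp_pi_mul_I]
  funext i
  fin_cases i
  · simp only [cyclicNodeExponents, Fin.zero_eta, Fin.isValue, Matrix.cons_val_zero]
    rw [hπ]; ring
  · simp only [cyclicNodeExponents, Fin.mk_one, Fin.isValue, Matrix.cons_val_one, Matrix.cons_val_zero]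
    rw [hπ]; ring
  · simp [cyclicNodeExponents]

end Rotation

/-! ### The model isotopy in a Morse chart -/

section ModelIsotopy

variable {ι : Type} [Fintype ι] (a : ι → ℕ) {E : Type*} [TopologicalSpace E]
  (Θ : OpenPartialHomeomorph E (ι → ℂ)) {r : ℝ}

/-- The weighted rotation preserves `Σ |zᵢ|²`. [cite: Milnor1968, §9 Lemma 9.4] -/
theorem sum_norm_sq_weightedRotation (θ : ℝ) (z : ι → ℂ) :
    ∑ i, ‖Complex.exp (((θ / a i : ℝ) : ℂ) * I) * z i‖ ^ 2 = ∑ i, ‖z i‖ ^ 2 := by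
  simp_rw [norm_weightedRotation_apply]

/-- In a chart `Θ` whose target contains the closed ball `Σ|zᵢ|² ≤ r²`: for `x` in the source with `Σ|(Θ x)ᵢ|² < r²`,
the rotated coordinates `R_θ(Θ x)` lie in the target, so `I(θ, x) = Θ⁻¹(R_θ(Θ x))` lies in the source, has
coordinates `R_θ(Θ x)`, and the same `Σ|·|² < r²`. [cite: Milnor1968, §9 Lemma 9.4] -/
theorem modelIsotopy_mem (hr : {z : ι → ℂ | ∑ i, ‖z i‖ ^ 2 ≤ r ^ 2} ⊆ Θ.target)
    {x : E} (hxr : ∑ i, ‖Θ x i‖ ^ 2 < r ^ 2) (θ : ℝ) :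
    Θ.symm (fun i => Complex.exp (((θ / a i : ℝ) : ℂ) * I) * Θ x i) ∈ Θ.source ∧
      (Θ (Θ.symm (fun i => Complex.exp (((θ / a i : ℝ) : ℂ) * I) * Θ x i)) =
        fun i => Complex.exp (((θ / a i : ℝ) : ℂ) * I) * Θ x i) ∧
      ∑ i, ‖Θ (Θ.symm (fun i => Complex.exp (((θ / a i : ℝ) : ℂ) * I) * Θ x i)) i‖ ^ 2 < r ^ 2 := by
  have hmem : (fun i => Complex.exp (((θ / a i : ℝ) : ℂ) * I) * Θ x i) ∈ Θ.target :=
    hr (by rw [mem_setOf_eq, sum_norm_sq_weightedRotation]; exact hxr.le)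
  refine ⟨Θ.map_target hmem, Θ.right_inv hmem, ?_⟩
  rw [Θ.right_inv hmem, sum_norm_sq_weightedRotation]
  exact hxr

/-- **The model isotopy covers the rotation of the values**: if `Σ (Θ x)ᵢ^{aᵢ} = φ x` on the source, then
`φ (I(θ, x)) = e^{iθ} · φ x`. [cite: Milnor1968, §9 Lemma 9.4] [cite: ArnoldGuseinzadeVarchenko2012, Part I §2.3] -/
theorem apply_modelIsotopy_eq_exp_mul (ha : ∀ i, a i ≠ 0) (hr : {z : ι → ℂ | ∑ i, ‖z i‖ ^ 2 ≤ r ^ 2} ⊆ Θ.target)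
    {φ : E → ℂ} (hφ : ∀ x ∈ Θ.source, ∑ i, (Θ x) i ^ a i = φ x)
    {x : E} (hx : x ∈ Θ.source) (hxr : ∑ i, ‖Θ x i‖ ^ 2 < r ^ 2) (θ : ℝ) :
    φ (Θ.symm (fun i => Complex.exp (((θ / a i : ℝ) : ℂ) * I) * Θ x i)) = Complex.exp ((θ : ℂ) * I) * φ x := by
  obtain ⟨hsrc, hΘ, -⟩ := modelIsotopy_mem a Θ hr hxr θ
  rw [← hφ _ hsrc, ← hφ _ hx, hΘ]
  exact sum_pow_weightedRotation a ha θ (Θ x)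

omit [Fintype ι] in
/-- `I(0, x) = x` on the source. [cite: Milnor1968, §9 Lemma 9.4] -/
theorem modelIsotopy_zero {x : E} (hx : x ∈ Θ.source) :
    Θ.symm (fun i => Complex.exp ((((0 : ℝ) / a i : ℝ) : ℂ) * I) * Θ x i) = x := by
  rw [weightedRotation_zero a (Θ x), Θ.left_inv hx]

/-- Flow law `I(θ + θ', x) = I(θ, I(θ', x))` inside the ball. [cite: Milnor1968, §9 Lemma 9.4] -/
theorem modelIsotopy_add (hr : {z : ι → ℂ | ∑ i, ‖z i‖ ^ 2 ≤ r ^ 2} ⊆ Θ.target)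
    {x : E} (hxr : ∑ i, ‖Θ x i‖ ^ 2 < r ^ 2) (θ θ' : ℝ) :
    Θ.symm (fun i => Complex.exp ((((θ + θ') / a i : ℝ) : ℂ) * I) * Θ x i) =
      Θ.symm (fun i => Complex.exp (((θ / a i : ℝ) : ℂ) * I) *
        Θ (Θ.symm (fun i => Complex.exp (((θ' / a i : ℝ) : ℂ) * I) * Θ x i)) i) := by
  obtain ⟨-, hΘ, -⟩ := modelIsotopy_mem a Θ hr hxr θ'
  rw [hΘ, weightedRotation_add a θ θ' (Θ x)]

/-- **At `θ = 2π` the model isotopy is the model monodromy read in the chart**: `Θ (I(2π, x)) = R_{2π} (Θ x)`.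
[cite: Milnor1968, §9 p. 77] -/
theorem chart_modelIsotopy_two_pi (hr : {z : ι → ℂ | ∑ i, ‖z i‖ ^ 2 ≤ r ^ 2} ⊆ Θ.target)
    {x : E} (hxr : ∑ i, ‖Θ x i‖ ^ 2 < r ^ 2) :
    Θ (Θ.symm (fun i => Complex.exp ((((2 * π) / a i : ℝ) : ℂ) * I) * Θ x i)) =
      fun i => Complex.exp ((((2 * π) / a i : ℝ) : ℂ) * I) * Θ x i :=
  (modelIsotopy_mem a Θ hr hxr (2 * π)).2.1

/-- The ball `{x ∈ source | Σ|(Θ x)ᵢ|² < r²}` of the chart (Milnor's open ball `B_ε` read through the coordinates)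
is open. [cite: Milnor1968, §9 Lemma 9.4] -/
theorem isOpen_chartBall : IsOpen (Θ.source ∩ {x | ∑ i, ‖Θ x i‖ ^ 2 < r ^ 2}) := by
  have hc : Continuous fun z : ι → ℂ => ∑ i, ‖z i‖ ^ 2 :=
    continuous_finsetSum _ fun i _ => ((continuous_apply i).norm).pow 2
  exact Θ.continuousOn.isOpen_inter_preimage (t := {z | ∑ i, ‖z i‖ ^ 2 < r ^ 2}) Θ.open_source
    (isOpen_lt hc continuous_const)

/-- **The model isotopy is jointly continuous on `ℝ × ball`.** [cite: Milnor1968, §9 Lemma 9.4] -/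
theorem continuousOn_modelIsotopy (hr : {z : ι → ℂ | ∑ i, ‖z i‖ ^ 2 ≤ r ^ 2} ⊆ Θ.target) :
    ContinuousOn (fun q : ℝ × E => Θ.symm (fun i => Complex.exp (((q.1 / a i : ℝ) : ℂ) * I) * Θ q.2 i))
      (univ ×ˢ (Θ.source ∩ {x | ∑ i, ‖Θ x i‖ ^ 2 < r ^ 2})) := by
  have hR : Continuous fun q : ℝ × (ι → ℂ) => fun i => Complex.exp (((q.1 / a i : ℝ) : ℂ) * I) * q.2 i :=
    continuous_weightedRotation a
  have h1 : ContinuousOn (fun q : ℝ × E => (q.1, Θ q.2)) (univ ×ˢ (Θ.source ∩ {x | ∑ i, ‖Θ x i‖ ^ 2 < r ^ 2})) :=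
    continuousOn_fst.prodMk (Θ.continuousOn.comp continuousOn_snd fun q hq => hq.2.1)
  have h2 := hR.comp_continuousOn h1
  refine Θ.continuousOn_symm.comp h2 fun q hq => ?_
  exact hr (by
    show ∑ i, ‖Complex.exp (((q.1 / a i : ℝ) : ℂ) * I) * Θ q.2 i‖ ^ 2 ≤ r ^ 2
    rw [sum_norm_sq_weightedRotation]; exact hq.2.2.le)

end ModelIsotopy

end PhamBrieskorn

end Literature.Geometry.ComplexAnalytic

end
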